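import Literature.Probability.LatticeModels.IsingFiniteEnergy
import Literature.Probability.LatticeModels.IsingThermodynamicsProofs
import Literature.Probability.LatticeModels.ButterflyLemma
import Literature.Probability.LatticeModels.StarBurtonKeane
import Literature.Probability.LatticeModels.HalfPlaneStates
import Literature.Probability.LatticeModels.LineTouchingIO
import HarnessLib

/-!
# Comparing the last axis sites of the `+∗`clusters of two independent layers
# (a replacement for Georgii–Higuchi 2000, Lemma 5.4)

Topic `Probability/LatticeModels`; theorems only. Georgii–Higuchi, J. Math. Phys. 41 (2000), proof of
Lemma 5.4 (fluctuations of the semi-infinite contour): with `a_n = max{k : (k, n) ∈ I^{+∗}_{π_{n,up}}}`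
and `d_n(ω, ω') = a_n(ω) - a_n(ω')` for two independent copies, "by symmetry, `ν(A) = ν(B)`" for
`A = {d_n ≥ 0 eventually}`, `B = {d_n ≤ 0 eventually}`, and the finite energy estimate
"`ν(B_{k,n} | 𝓕 ⊗ 𝓕)(ω, ω') ≥ [1 + e^{8β}]^{-4} ≡ δ`" obtained by changing the spins at two sites.

We use the same two ingredients — **exchangeability of `μ ⊗ μ`** and the **finite energy property at
a single axis site** — at a *fixed* level, which is all our contour-free form of Lemma 5.5 needs.
For a configuration `ω` let `R_j(ω)` be the event "some infinite `+∗`cluster of the upper half-plane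
has an axis site `(k, 0)` with `k ≥ j`" (written out as a set; increasing in `ω`, decreasing in `j`);
when the infinite `+∗`cluster is unique with last axis site `(a, 0)`, `R_j = {j ≤ a}`.

* `measurableSet_axisReach`, `axisReach_mono_config`, `axisReach_anti` — measurability and
  monotonicity;
* `mul_measure_axisReach_sdiff_le` — **finite energy**: `δ₀ μ(R_j ∖ R_{j+1}) ≤ μ(R_{j+1})`,
  `δ₀ = e^{-8|β|}/2`, by setting the spin at `(j+1, 0)` to `+1`
  (`IsGibbsMeasure.mul_measure_glueWith_preimage_le`); hence the **anti-concentration**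
  `(1 + δ₀) μ(R_j ∖ R_{j+1}) ≤ 1`;
* `measure_lt_eq_measure_gt` — **exchangeability**: under `μ ⊗ μ` the events "`a(ω) < a(ω')`" and
  "`a(ω') < a(ω)`" (written with the `R_j`) have the same probability (`Measure.prod_swap`);
* `measure_tie_le` — ties have probability `≤ 1/(1 + δ₀)`;
* **`le_measure_axisReach_gt`**, **`half_le_measure_axisReach_ge`** — if almost surely the last axis
  site exists (`⋃_j R_j ∖ R_{j+1}` has full measure), then `(μ ⊗ μ)(a(ω) < a(ω')) ≥ δ₀/(2(1+δ₀))` and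
  `(μ ⊗ μ)(a(ω) ≤ a(ω')) ≥ 1/2`;
* `axisReach_configShift` and **`le_measure_axisReach_shift`** — for the horizontally shifted second
  layer `μ ⊗ (μ ∘ θ_{s e₁}⁻¹)`, `s = ±1`, the event "`a(ω) ≤ a(ω̂)`" has probability `≥ δ₀/(2(1+δ₀))`.

## References

* H.-O. Georgii, Y. Higuchi, J. Math. Phys. 41 (2000) 1153–1169, proof of Lemma 5.4 (p. 14)
  [GeorgiiHiguchi2000].
-/

noncomputable section

open MeasureTheory Filter SimpleGraph Finset
open Literature.Probability.Percolation
open scoped ENNReal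

namespace Literature.Probability.LatticeModels

/-! ### The events `R_j` -/

section Events

/-- `ω ↦ S⁺(ω) ∩ π_up` is measurable. [folklore] -/
theorem measurable_spinSites_inter_halfPlane (s : ℤˣ) :
    Measurable fun ω : SpinConfig (Site 2) => spinSites s ω ∩ halfPlane 0 := by
  have h := measurable_spinSites_inter_diff (V := Site 2) s (halfPlane 0) ∅
  simp only [Finset.coe_empty, Set.sdiff_empty] at h
  exact h.mono cylinderEvents_le_pi le_rfl

/-- The event "the `+∗`cluster of the upper half-plane through `z` is infinite" is measurable. [folklore] -/
theorem measurableSet_infinite_plusStarCluster (z : Site 2) :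
    MeasurableSet {ω : SpinConfig (Site 2) | (siteCluster zdStarGraph (spinSites 1 ω ∩ halfPlane 0) z).Infinite} := by
  classical
  exact measurable_spinSites_inter_halfPlane 1 (measurableSet_sitePercolatesAt (G := zdStarGraph) z)

/-- **`R_j` is measurable.** [folklore] -/
theorem measurableSet_axisReach (j : ℤ) :
    MeasurableSet {ω : SpinConfig (Site 2) | ∃ k : ℤ, j ≤ k ∧
      (siteCluster zdStarGraph (spinSites 1 ω ∩ halfPlane 0) ![k, 0]).Infinite} := by
  have : {ω : SpinConfig (Site 2) | ∃ k : ℤ, j ≤ k ∧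
      (siteCluster zdStarGraph (spinSites 1 ω ∩ halfPlane 0) ![k, 0]).Infinite} =
      ⋃ k : ℤ, ⋃ (_ : j ≤ k), {ω | (siteCluster zdStarGraph (spinSites 1 ω ∩ halfPlane 0) ![k, 0]).Infinite} := by
    ext ω; simp
  rw [this]
  exact MeasurableSet.iUnion fun k => MeasurableSet.iUnion fun _ => measurableSet_infinite_plusStarCluster _

/-- **`R_j` is increasing in the configuration.** [folklore] -/
theorem axisReach_mono_config {j : ℤ} {ω ω' : SpinConfig (Site 2)} (h : ω ≤ ω')
    (hω : ∃ k : ℤ, j ≤ k ∧ (siteCluster zdStarGraph (spinSites 1 ω ∩ halfPlane 0) ![k, 0]).Infinite) :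
    ∃ k : ℤ, j ≤ k ∧ (siteCluster zdStarGraph (spinSites 1 ω' ∩ halfPlane 0) ![k, 0]).Infinite := by
  obtain ⟨k, hk, hinf⟩ := hω
  exact ⟨k, hk, hinf.mono (siteCluster_mono (Set.inter_subset_inter_left _ (spinSites_one_mono h)) _)⟩

/-- **`R_j` is decreasing in `j`.** [folklore] -/
theorem axisReach_anti {j j' : ℤ} (hjj' : j ≤ j') {ω : SpinConfig (Site 2)}
    (hω : ∃ k : ℤ, j' ≤ k ∧ (siteCluster zdStarGraph (spinSites 1 ω ∩ halfPlane 0) ![k, 0]).Infinite) :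
    ∃ k : ℤ, j ≤ k ∧ (siteCluster zdStarGraph (spinSites 1 ω ∩ halfPlane 0) ![k, 0]).Infinite := by
  obtain ⟨k, hk, hinf⟩ := hω
  exact ⟨k, hjj'.trans hk, hinf⟩

end Events

/-! ### Finite energy at one axis site -/

section FiniteEnergy

variable {β : ℝ} {μ : Measure (SpinConfig (Site 2))}

/-- The finite energy constant of a single site of `ℤ²` is at least `e^{-8|β|}/2`. [cite: GeorgiiHiguchi2000, Lemma 5.4 (proof, p. 14)] -/
theorem exp_div_two_le_finiteEnergyConst (β : ℝ) (z : Site 2) :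
    Real.exp (-(8 * |β|)) / 2 ≤
      Real.exp (-(2 * |β| * (#(edgesTouching (zdGraph 2) {z}) + |(0 : ℝ)| * #({z} : Finset (Site 2))))) /
        2 ^ #({z} : Finset (Site 2)) := by
  have hcard : (#(edgesTouching (zdGraph 2) {z}) : ℝ) ≤ 4 := by
    have h1 : edgesTouching (zdGraph 2) {z} = (zdGraph 2).incidenceFinset z := by
      simp [edgesTouching]
    rw [h1]
    exact_mod_cast card_incidenceFinset_zdGraph_le z
  rw [Finset.card_singleton, pow_one, abs_zero, zero_mul, add_zero]
  refine div_le_div_of_nonneg_right (Real.exp_le_exp.2 ?_) zero_le_two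
  have hβ : 0 ≤ |β| := abs_nonneg β
  nlinarith

/-- **Finite energy at the site `(j+1, 0)`**: `δ₀ μ(R_j ∖ R_{j+1}) ≤ μ(R_{j+1})`, `δ₀ = e^{-8|β|}/2`:
setting the spin at `(j+1, 0)` to `+1` maps `R_j ∖ R_{j+1}` into `R_{j+1}`, since then `(j+1, 0)` is
a `+`site lattice-adjacent to the axis site `(j, 0)` of an infinite `+∗`cluster (Georgii–Higuchi 2000,
proof of Lemma 5.4, the events `B_{k,n}`). [cite: GeorgiiHiguchi2000, Lemma 5.4 (proof, p. 14)] -/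
theorem mul_measure_axisReach_sdiff_le (hμ : μ ∈ isingGibbsMeasures 2 β 0) (j : ℤ) :
    ENNReal.ofReal (Real.exp (-(8 * |β|)) / 2) *
        μ ({ω | ∃ k : ℤ, j ≤ k ∧ (siteCluster zdStarGraph (spinSites 1 ω ∩ halfPlane 0) ![k, 0]).Infinite} \
          {ω | ∃ k : ℤ, j + 1 ≤ k ∧ (siteCluster zdStarGraph (spinSites 1 ω ∩ halfPlane 0) ![k, 0]).Infinite}) ≤
      μ {ω | ∃ k : ℤ, j + 1 ≤ k ∧ (siteCluster zdStarGraph (spinSites 1 ω ∩ halfPlane 0) ![k, 0]).Infinite} := by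
  classical
  have hμG : IsGibbsMeasure (isingSpecification (zdGraph 2) β 0) μ := hμ
  set z : Site 2 := ![j + 1, 0] with hz
  set S := {ω : SpinConfig (Site 2) | ∃ k : ℤ, j + 1 ≤ k ∧
    (siteCluster zdStarGraph (spinSites 1 ω ∩ halfPlane 0) ![k, 0]).Infinite} with hS
  have key := hμG.mul_measure_glueWith_preimage_le (G := zdGraph 2) {z} (fun _ => (1 : ℤˣ)) (measurableSet_axisReach (j + 1))
  -- the glued configuration of `R_j ∖ R_{j+1}` lies in `R_{j+1}`
  have hsub : {ω : SpinConfig (Site 2) | ∃ k : ℤ, j ≤ k ∧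
      (siteCluster zdStarGraph (spinSites 1 ω ∩ halfPlane 0) ![k, 0]).Infinite} \ S ⊆
      {η | glueWith {z} (fun _ => (1 : ℤˣ)) η ∈ S} := by
    rintro ω ⟨⟨k, hjk, hinf⟩, hnot⟩
    have hk : k = j := by
      by_contra hne
      exact hnot ⟨k, by omega, hinf⟩
    subst hk
    set η := glueWith {z} (fun _ => (1 : ℤˣ)) ω with hη
    have hle : ω ≤ η := fun x => by
      by_cases hx : x ∈ ({z} : Finset (Site 2))
      · rw [hη, glueWith_apply_mem _ _ _ hx]; exact intUnits_le_one _
      · rw [hη, glueWith_apply_not_mem _ _ _ hx]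
    have hinf' : (siteCluster zdStarGraph (spinSites 1 η ∩ halfPlane 0) ![k, 0]).Infinite :=
      hinf.mono (siteCluster_mono (Set.inter_subset_inter_left _ (spinSites_one_mono hle)) _)
    have hk0 : (![k, 0] : Site 2) ∈ siteCluster zdStarGraph (spinSites 1 η ∩ halfPlane 0) ![k, 0] :=
      (mem_siteCluster_self_iff _ _ _).2 hinf'.nonempty.some_mem.1
    have hz1 : η z = 1 := by rw [hη, glueWith_apply_mem _ _ _ (Finset.mem_singleton_self z)]
    have hzO : z ∈ spinSites 1 η ∩ halfPlane 0 := ⟨hz1, by simp [hz, halfPlane]⟩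
    have hadj : zdStarGraph.Adj (![k, 0] : Site 2) z := by
      refine zdGraph_le_zdStarGraph ?_
      rw [zdGraph_two_adj_iff]; simp [hz]
    have hzC : z ∈ siteCluster zdStarGraph (spinSites 1 η ∩ halfPlane 0) ![k, 0] := mem_siteCluster_of_adj hk0 hzO hadj
    refine ⟨k + 1, le_rfl, ?_⟩
    have heq : siteCluster zdStarGraph (spinSites 1 η ∩ halfPlane 0) ![k + 1, 0] =
        siteCluster zdStarGraph (spinSites 1 η ∩ halfPlane 0) ![k, 0] := by
      ext w
      constructor
      · rintro ⟨hz', hw, hr⟩; exact ⟨hk0.1, hw, hzC.2.2.trans hr⟩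
      · rintro ⟨hk', hw, hr⟩; exact ⟨hzO, hw, hzC.2.2.symm.trans hr⟩
    rw [heq]; exact hinf'
  calc ENNReal.ofReal (Real.exp (-(8 * |β|)) / 2) * μ (_ \ S)
      ≤ ENNReal.ofReal (Real.exp (-(2 * |β| * (#(edgesTouching (zdGraph 2) {z}) + |(0 : ℝ)| * #({z} : Finset (Site 2))))) /
          2 ^ #({z} : Finset (Site 2))) * μ {η | glueWith {z} (fun _ => (1 : ℤˣ)) η ∈ S} :=
        mul_le_mul' (ENNReal.ofReal_le_ofReal (exp_div_two_le_finiteEnergyConst β z)) (measure_mono hsub)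
    _ ≤ μ S := key

/-- **Anti-concentration of the last axis site**: `(1 + δ₀) μ(R_j ∖ R_{j+1}) ≤ 1`. [cite: GeorgiiHiguchi2000, Lemma 5.4 (proof, p. 14)] -/
theorem measure_axisReach_sdiff_le (hμ : μ ∈ isingGibbsMeasures 2 β 0) (j : ℤ) :
    (1 + ENNReal.ofReal (Real.exp (-(8 * |β|)) / 2)) *
        μ ({ω | ∃ k : ℤ, j ≤ k ∧ (siteCluster zdStarGraph (spinSites 1 ω ∩ halfPlane 0) ![k, 0]).Infinite} \
          {ω | ∃ k : ℤ, j + 1 ≤ k ∧ (siteCluster zdStarGraph (spinSites 1 ω ∩ halfPlane 0) ![k, 0]).Infinite}) ≤ 1 := by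
  have hμG : IsGibbsMeasure (isingSpecification (zdGraph 2) β 0) μ := hμ
  haveI := hμG.isProbabilityMeasure
  set A := {ω : SpinConfig (Site 2) | ∃ k : ℤ, j ≤ k ∧
    (siteCluster zdStarGraph (spinSites 1 ω ∩ halfPlane 0) ![k, 0]).Infinite} with hA
  set S := {ω : SpinConfig (Site 2) | ∃ k : ℤ, j + 1 ≤ k ∧
    (siteCluster zdStarGraph (spinSites 1 ω ∩ halfPlane 0) ![k, 0]).Infinite} with hS
  rw [add_mul, one_mul]
  calc μ (A \ S) + ENNReal.ofReal (Real.exp (-(8 * |β|)) / 2) * μ (A \ S) ≤ μ (A \ S) + μ S :=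
        add_le_add le_rfl (mul_measure_axisReach_sdiff_le hμ j)
    _ = μ (A \ S ∪ S) := (measure_union Set.disjoint_sdiff_left (measurableSet_axisReach (j + 1))).symm
    _ ≤ 1 := prob_le_one

end FiniteEnergy

/-! ### Exchangeability -/

section Exchange

variable {β : ℝ} {μ : Measure (SpinConfig (Site 2))}

/-- **Exchangeability** (Georgii–Higuchi 2000, proof of Lemma 5.4: "by symmetry, `ν(A) = ν(B)`"):
under `μ ⊗ μ`, "`a(ω) < a(ω')`" and "`a(ω') < a(ω)`" are equally likely. [cite: GeorgiiHiguchi2000, Lemma 5.4 (proof, p. 14)] -/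
theorem measure_lt_eq_measure_gt [SFinite μ] :
    (μ.prod μ) {p : SpinConfig (Site 2) × SpinConfig (Site 2) | ∃ j : ℤ,
        (¬ ∃ k : ℤ, j ≤ k ∧ (siteCluster zdStarGraph (spinSites 1 p.1 ∩ halfPlane 0) ![k, 0]).Infinite) ∧
        (∃ k : ℤ, j ≤ k ∧ (siteCluster zdStarGraph (spinSites 1 p.2 ∩ halfPlane 0) ![k, 0]).Infinite)} =
      (μ.prod μ) {p : SpinConfig (Site 2) × SpinConfig (Site 2) | ∃ j : ℤ,
        (¬ ∃ k : ℤ, j ≤ k ∧ (siteCluster zdStarGraph (spinSites 1 p.2 ∩ halfPlane 0) ![k, 0]).Infinite) ∧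
        (∃ k : ℤ, j ≤ k ∧ (siteCluster zdStarGraph (spinSites 1 p.1 ∩ halfPlane 0) ![k, 0]).Infinite)} := by
  set X := {p : SpinConfig (Site 2) × SpinConfig (Site 2) | ∃ j : ℤ,
    (¬ ∃ k : ℤ, j ≤ k ∧ (siteCluster zdStarGraph (spinSites 1 p.1 ∩ halfPlane 0) ![k, 0]).Infinite) ∧
    (∃ k : ℤ, j ≤ k ∧ (siteCluster zdStarGraph (spinSites 1 p.2 ∩ halfPlane 0) ![k, 0]).Infinite)} with hX
  have hXm : MeasurableSet X := by
    have : X = ⋃ j : ℤ, ({ω : SpinConfig (Site 2) | ∃ k : ℤ, j ≤ k ∧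
        (siteCluster zdStarGraph (spinSites 1 ω ∩ halfPlane 0) ![k, 0]).Infinite}ᶜ ×ˢ
        {ω : SpinConfig (Site 2) | ∃ k : ℤ, j ≤ k ∧
          (siteCluster zdStarGraph (spinSites 1 ω ∩ halfPlane 0) ![k, 0]).Infinite}) := by
      ext p; simp [hX, Set.mem_prod]
    rw [this]
    exact MeasurableSet.iUnion fun j => (measurableSet_axisReach j).compl.prod (measurableSet_axisReach j)
  have hswap : {p : SpinConfig (Site 2) × SpinConfig (Site 2) | ∃ j : ℤ,
      (¬ ∃ k : ℤ, j ≤ k ∧ (siteCluster zdStarGraph (spinSites 1 p.2 ∩ halfPlane 0) ![k, 0]).Infinite) ∧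
      (∃ k : ℤ, j ≤ k ∧ (siteCluster zdStarGraph (spinSites 1 p.1 ∩ halfPlane 0) ![k, 0]).Infinite)} =
      Prod.swap ⁻¹' X := by
    ext p; simp [hX]
  rw [hswap, ← Measure.map_apply measurable_swap hXm, Measure.prod_swap]

/-- **Ties are not too likely**: `(μ ⊗ μ)(a(ω) = a(ω')) ≤ 1/(1 + δ₀)` (from the anti-concentration and
the disjointness of the events `R_j ∖ R_{j+1}`). [cite: GeorgiiHiguchi2000, Lemma 5.4 (proof, p. 14)] -/
theorem measure_tie_le (hμ : μ ∈ isingGibbsMeasures 2 β 0) :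
    (μ.prod μ) {p : SpinConfig (Site 2) × SpinConfig (Site 2) | ∃ j : ℤ,
        (p.1 ∈ {ω : SpinConfig (Site 2) | ∃ k : ℤ, j ≤ k ∧ (siteCluster zdStarGraph (spinSites 1 ω ∩ halfPlane 0) ![k, 0]).Infinite} \
          {ω | ∃ k : ℤ, j + 1 ≤ k ∧ (siteCluster zdStarGraph (spinSites 1 ω ∩ halfPlane 0) ![k, 0]).Infinite}) ∧
        (p.2 ∈ {ω : SpinConfig (Site 2) | ∃ k : ℤ, j ≤ k ∧ (siteCluster zdStarGraph (spinSites 1 ω ∩ halfPlane 0) ![k, 0]).Infinite} \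
          {ω | ∃ k : ℤ, j + 1 ≤ k ∧ (siteCluster zdStarGraph (spinSites 1 ω ∩ halfPlane 0) ![k, 0]).Infinite})} ≤
      (1 + ENNReal.ofReal (Real.exp (-(8 * |β|)) / 2))⁻¹ := by
  have hμG : IsGibbsMeasure (isingSpecification (zdGraph 2) β 0) μ := hμ
  haveI := hμG.isProbabilityMeasure
  set E : ℤ → Set (SpinConfig (Site 2)) := fun j =>
    {ω : SpinConfig (Site 2) | ∃ k : ℤ, j ≤ k ∧ (siteCluster zdStarGraph (spinSites 1 ω ∩ halfPlane 0) ![k, 0]).Infinite} \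
      {ω | ∃ k : ℤ, j + 1 ≤ k ∧ (siteCluster zdStarGraph (spinSites 1 ω ∩ halfPlane 0) ![k, 0]).Infinite} with hE
  set d := ENNReal.ofReal (Real.exp (-(8 * |β|)) / 2) with hd
  have hEm : ∀ j, MeasurableSet (E j) := fun j => (measurableSet_axisReach j).diff (measurableSet_axisReach (j + 1))
  have hEj : ∀ j, μ (E j) ≤ (1 + d)⁻¹ := fun j => by
    rw [ENNReal.le_inv_iff_mul_le, mul_comm]
    exact measure_axisReach_sdiff_le hμ j
  -- disjointness of the `E j`
  have hdisj : Pairwise (Function.onFun Disjoint E) := by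
    intro i j hij
    rw [Function.onFun, Set.disjoint_iff]
    rintro ω ⟨⟨⟨k, hik, hk⟩, hni⟩, ⟨⟨k', hjk', hk'⟩, hnj⟩⟩
    rcases lt_or_gt_of_ne hij with h | h
    · exact hni ⟨k', by omega, hk'⟩
    · exact hnj ⟨k, by omega, hk⟩
  have hset : {p : SpinConfig (Site 2) × SpinConfig (Site 2) | ∃ j : ℤ, p.1 ∈ E j ∧ p.2 ∈ E j} = ⋃ j, E j ×ˢ E j := by
    ext p; simp [Set.mem_prod]
  calc (μ.prod μ) {p : SpinConfig (Site 2) × SpinConfig (Site 2) | ∃ j : ℤ, p.1 ∈ E j ∧ p.2 ∈ E j}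
      = (μ.prod μ) (⋃ j, E j ×ˢ E j) := by rw [hset]
    _ ≤ ∑' j, (μ.prod μ) (E j ×ˢ E j) := measure_iUnion_le _
    _ = ∑' j, μ (E j) * μ (E j) := by simp_rw [Measure.prod_prod]
    _ ≤ ∑' j, (1 + d)⁻¹ * μ (E j) := ENNReal.tsum_le_tsum fun j => mul_le_mul' (hEj j) le_rfl
    _ = (1 + d)⁻¹ * ∑' j, μ (E j) := ENNReal.tsum_mul_left
    _ = (1 + d)⁻¹ * μ (⋃ j, E j) := by rw [measure_iUnion hdisj hEm]
    _ ≤ (1 + d)⁻¹ * 1 := mul_le_mul' le_rfl prob_le_one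
    _ = (1 + d)⁻¹ := mul_one _

/-- **The last axis site of the second copy is strictly to the right with probability at least
`δ₀/(2(1+δ₀))`**, provided the last axis site exists almost surely (the events `R_j ∖ R_{j+1}` cover a
set of full measure): exchangeability, ties, and the covering
`{a exists}² ⊆ {a(ω) < a(ω')} ∪ {a(ω') < a(ω)} ∪ {a(ω) = a(ω')}`. [cite: GeorgiiHiguchi2000, Lemma 5.4 (proof, p. 14)] -/
theorem le_measure_axisReach_gt (hμ : μ ∈ isingGibbsMeasures 2 β 0)
    (hexists : ∀ᵐ ω ∂μ, ∃ j : ℤ, ω ∈ {ω : SpinConfig (Site 2) | ∃ k : ℤ, j ≤ k ∧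
        (siteCluster zdStarGraph (spinSites 1 ω ∩ halfPlane 0) ![k, 0]).Infinite} \
      {ω | ∃ k : ℤ, j + 1 ≤ k ∧ (siteCluster zdStarGraph (spinSites 1 ω ∩ halfPlane 0) ![k, 0]).Infinite}) :
    (1 - (1 + ENNReal.ofReal (Real.exp (-(8 * |β|)) / 2))⁻¹) / 2 ≤
      (μ.prod μ) {p : SpinConfig (Site 2) × SpinConfig (Site 2) | ∃ j : ℤ,
        (¬ ∃ k : ℤ, j ≤ k ∧ (siteCluster zdStarGraph (spinSites 1 p.1 ∩ halfPlane 0) ![k, 0]).Infinite) ∧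
        (∃ k : ℤ, j ≤ k ∧ (siteCluster zdStarGraph (spinSites 1 p.2 ∩ halfPlane 0) ![k, 0]).Infinite)} := by
  have hμG : IsGibbsMeasure (isingSpecification (zdGraph 2) β 0) μ := hμ
  haveI := hμG.isProbabilityMeasure
  set R : ℤ → Set (SpinConfig (Site 2)) := fun j =>
    {ω : SpinConfig (Site 2) | ∃ k : ℤ, j ≤ k ∧ (siteCluster zdStarGraph (spinSites 1 ω ∩ halfPlane 0) ![k, 0]).Infinite} with hR
  set Xgt := {p : SpinConfig (Site 2) × SpinConfig (Site 2) | ∃ j : ℤ, p.1 ∉ R j ∧ p.2 ∈ R j} with hXgt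
  set Xlt := {p : SpinConfig (Site 2) × SpinConfig (Site 2) | ∃ j : ℤ, p.2 ∉ R j ∧ p.1 ∈ R j} with hXlt
  set Xeq := {p : SpinConfig (Site 2) × SpinConfig (Site 2) | ∃ j : ℤ, p.1 ∈ R j \ R (j + 1) ∧ p.2 ∈ R j \ R (j + 1)} with hXeq
  have hanti : ∀ {j j' : ℤ} {ω}, j ≤ j' → ω ∈ R j' → ω ∈ R j := fun hjj' h => axisReach_anti hjj' h
  -- covering
  have hcover : {ω : SpinConfig (Site 2) | ∃ j, ω ∈ R j \ R (j + 1)} ×ˢ {ω : SpinConfig (Site 2) | ∃ j, ω ∈ R j \ R (j + 1)} ⊆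
      Xgt ∪ Xlt ∪ Xeq := by
    rintro ⟨ω, ω'⟩ ⟨⟨j, hj, hj'⟩, ⟨i, hi, hi'⟩⟩
    rcases lt_trichotomy j i with h | rfl | h
    · exact Or.inl (Or.inl ⟨j + 1, hj', hanti (by omega) hi⟩)
    · exact Or.inr ⟨j, ⟨hj, hj'⟩, hi, hi'⟩
    · exact Or.inl (Or.inr ⟨i + 1, hi', hanti (by omega) hj⟩)
  have hfull : (μ.prod μ) ({ω : SpinConfig (Site 2) | ∃ j, ω ∈ R j \ R (j + 1)} ×ˢ
      {ω : SpinConfig (Site 2) | ∃ j, ω ∈ R j \ R (j + 1)}) = 1 := by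
    have hmeas : MeasurableSet {ω : SpinConfig (Site 2) | ∃ j, ω ∈ R j \ R (j + 1)} := by
      have : {ω : SpinConfig (Site 2) | ∃ j, ω ∈ R j \ R (j + 1)} = ⋃ j, R j \ R (j + 1) := by
        ext ω; simp
      rw [this]
      exact MeasurableSet.iUnion fun j => (measurableSet_axisReach j).diff (measurableSet_axisReach (j + 1))
    have hexists' : ∀ᵐ ω ∂μ, ∃ j, ω ∈ R j \ R (j + 1) := hexists
    have h1 : μ {ω : SpinConfig (Site 2) | ∃ j, ω ∈ R j \ R (j + 1)} = 1 := by
      rw [← prob_compl_eq_zero_iff hmeas]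
      rw [ae_iff] at hexists'
      simpa only [Set.compl_setOf] using hexists'
    rw [Measure.prod_prod, h1, one_mul]
  have heq := measure_lt_eq_measure_gt (μ := μ)
  have htie := measure_tie_le hμ
  -- `1 ≤ ν(Xgt) + ν(Xlt) + ν(Xeq) = 2 ν(Xgt) + ν(Xeq)`
  have h1 : (1 : ℝ≥0∞) ≤ (μ.prod μ) Xgt + (μ.prod μ) Xlt + (μ.prod μ) Xeq := by
    rw [← hfull]
    exact (measure_mono hcover).trans ((measure_union_le _ _).trans (add_le_add (measure_union_le _ _) le_rfl))
  change (μ.prod μ) Xgt = (μ.prod μ) Xlt at heq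
  rw [← heq] at h1
  have h2 : (1 : ℝ≥0∞) ≤ 2 * (μ.prod μ) Xgt + (1 + ENNReal.ofReal (Real.exp (-(8 * |β|)) / 2))⁻¹ := by
    calc (1 : ℝ≥0∞) ≤ (μ.prod μ) Xgt + (μ.prod μ) Xgt + (μ.prod μ) Xeq := h1
      _ ≤ 2 * (μ.prod μ) Xgt + (1 + ENNReal.ofReal (Real.exp (-(8 * |β|)) / 2))⁻¹ := by
          rw [two_mul]; exact add_le_add le_rfl htie
  -- rearrange
  have hinv_le : (1 + ENNReal.ofReal (Real.exp (-(8 * |β|)) / 2))⁻¹ ≤ 1 := ENNReal.inv_le_one.2 le_self_add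
  have h3 : 1 - (1 + ENNReal.ofReal (Real.exp (-(8 * |β|)) / 2))⁻¹ ≤ 2 * (μ.prod μ) Xgt :=
    tsub_le_iff_right.2 h2
  calc (1 - (1 + ENNReal.ofReal (Real.exp (-(8 * |β|)) / 2))⁻¹) / 2
      ≤ 2 * (μ.prod μ) Xgt / 2 := ENNReal.div_le_div_right h3 2
    _ = (μ.prod μ) Xgt := by
        rw [mul_comm]; exact ENNReal.mul_div_cancel_right two_ne_zero ENNReal.ofNat_ne_top

/-- **The last axis site of the second copy is not to the left with probability at least `1/2`**
(exchangeability alone; same hypothesis). [cite: GeorgiiHiguchi2000, Lemma 5.4 (proof, p. 14)] -/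
theorem half_le_measure_axisReach_ge (hμ : μ ∈ isingGibbsMeasures 2 β 0)
    (hexists : ∀ᵐ ω ∂μ, ∃ j : ℤ, ω ∈ {ω : SpinConfig (Site 2) | ∃ k : ℤ, j ≤ k ∧
        (siteCluster zdStarGraph (spinSites 1 ω ∩ halfPlane 0) ![k, 0]).Infinite} \
      {ω | ∃ k : ℤ, j + 1 ≤ k ∧ (siteCluster zdStarGraph (spinSites 1 ω ∩ halfPlane 0) ![k, 0]).Infinite}) :
    1 / 2 ≤ (μ.prod μ) {p : SpinConfig (Site 2) × SpinConfig (Site 2) | ∃ j : ℤ,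
        (¬ ∃ k : ℤ, j + 1 ≤ k ∧ (siteCluster zdStarGraph (spinSites 1 p.1 ∩ halfPlane 0) ![k, 0]).Infinite) ∧
        (∃ k : ℤ, j ≤ k ∧ (siteCluster zdStarGraph (spinSites 1 p.2 ∩ halfPlane 0) ![k, 0]).Infinite)} := by
  have hμG : IsGibbsMeasure (isingSpecification (zdGraph 2) β 0) μ := hμ
  haveI := hμG.isProbabilityMeasure
  set R : ℤ → Set (SpinConfig (Site 2)) := fun j =>
    {ω : SpinConfig (Site 2) | ∃ k : ℤ, j ≤ k ∧ (siteCluster zdStarGraph (spinSites 1 ω ∩ halfPlane 0) ![k, 0]).Infinite} with hR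
  set Xgt := {p : SpinConfig (Site 2) × SpinConfig (Site 2) | ∃ j : ℤ, p.1 ∉ R j ∧ p.2 ∈ R j} with hXgt
  set Xlt := {p : SpinConfig (Site 2) × SpinConfig (Site 2) | ∃ j : ℤ, p.2 ∉ R j ∧ p.1 ∈ R j} with hXlt
  set Xge := {p : SpinConfig (Site 2) × SpinConfig (Site 2) | ∃ j : ℤ, p.1 ∉ R (j + 1) ∧ p.2 ∈ R j} with hXge
  have hanti : ∀ {j j' : ℤ} {ω}, j ≤ j' → ω ∈ R j' → ω ∈ R j := fun hjj' h => axisReach_anti hjj' h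
  have hcover : {ω : SpinConfig (Site 2) | ∃ j, ω ∈ R j \ R (j + 1)} ×ˢ {ω : SpinConfig (Site 2) | ∃ j, ω ∈ R j \ R (j + 1)} ⊆
      Xge ∪ Xlt := by
    rintro ⟨ω, ω'⟩ ⟨⟨j, hj, hj'⟩, ⟨i, hi, hi'⟩⟩
    rcases le_or_gt j i with h | h
    · exact Or.inl ⟨j, hj', hanti h hi⟩
    · exact Or.inr ⟨i + 1, hi', hanti (by omega) hj⟩
  have hfull : (μ.prod μ) ({ω : SpinConfig (Site 2) | ∃ j, ω ∈ R j \ R (j + 1)} ×ˢ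
      {ω : SpinConfig (Site 2) | ∃ j, ω ∈ R j \ R (j + 1)}) = 1 := by
    have hmeas : MeasurableSet {ω : SpinConfig (Site 2) | ∃ j, ω ∈ R j \ R (j + 1)} := by
      have : {ω : SpinConfig (Site 2) | ∃ j, ω ∈ R j \ R (j + 1)} = ⋃ j, R j \ R (j + 1) := by
        ext ω; simp
      rw [this]
      exact MeasurableSet.iUnion fun j => (measurableSet_axisReach j).diff (measurableSet_axisReach (j + 1))
    have hexists' : ∀ᵐ ω ∂μ, ∃ j, ω ∈ R j \ R (j + 1) := hexists
    have h1 : μ {ω : SpinConfig (Site 2) | ∃ j, ω ∈ R j \ R (j + 1)} = 1 := by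
      rw [← prob_compl_eq_zero_iff hmeas]
      rw [ae_iff] at hexists'
      simpa only [Set.compl_setOf] using hexists'
    rw [Measure.prod_prod, h1, one_mul]
  have heq : (μ.prod μ) Xgt = (μ.prod μ) Xlt := measure_lt_eq_measure_gt (μ := μ)
  have hsub : Xgt ⊆ Xge := fun p ⟨j, h1, h2⟩ => ⟨j, fun h => h1 (hanti (by omega) h), h2⟩
  have h1 : (1 : ℝ≥0∞) ≤ (μ.prod μ) Xge + (μ.prod μ) Xge := by
    calc (1 : ℝ≥0∞) = _ := hfull.symm
      _ ≤ (μ.prod μ) Xge + (μ.prod μ) Xlt := (measure_mono hcover).trans (measure_union_le _ _)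
      _ = (μ.prod μ) Xge + (μ.prod μ) Xgt := by rw [heq]
      _ ≤ (μ.prod μ) Xge + (μ.prod μ) Xge := add_le_add le_rfl (measure_mono hsub)
  rw [← two_mul] at h1
  calc (1 : ℝ≥0∞) / 2 ≤ 2 * (μ.prod μ) Xge / 2 := ENNReal.div_le_div_right h1 2
    _ = (μ.prod μ) Xge := by
        rw [mul_comm]; exact ENNReal.mul_div_cancel_right two_ne_zero ENNReal.ofNat_ne_top

end Exchange

/-! ### The horizontally shifted second layer -/

section Shift

variable {β : ℝ} {μ : Measure (SpinConfig (Site 2))}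

/-- Horizontal shifts preserve the upper half-plane. [folklore] -/
theorem image_starShiftIso_inter_halfPlane (s : ℤ) (S : Set (Site 2)) :
    (starShiftIso (Pi.single 0 s)) '' (S ∩ halfPlane 0) = (starShiftIso (Pi.single 0 s)) '' S ∩ halfPlane 0 := by
  ext z
  simp only [Set.mem_image, Set.mem_inter_iff, starShiftIso_apply, halfPlane, Set.mem_setOf_eq]
  constructor
  · rintro ⟨y, ⟨hy, hy1⟩, rfl⟩
    exact ⟨⟨y, hy, rfl⟩, by simpa using hy1⟩
  · rintro ⟨⟨y, hy, rfl⟩, hz1⟩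
    exact ⟨y, ⟨hy, by simpa using hz1⟩, rfl⟩

/-- **Shift covariance of `R_j`**: `θ_{s e₁} ω ∈ R_j ↔ ω ∈ R_{j-s}`. [folklore] -/
theorem axisReach_configShift_iff (s j : ℤ) (ω : SpinConfig (Site 2)) :
    (∃ k : ℤ, j ≤ k ∧ (siteCluster zdStarGraph (spinSites 1 (configShift (Pi.single 0 s) ω) ∩ halfPlane 0) ![k, 0]).Infinite) ↔
      ∃ k : ℤ, j - s ≤ k ∧ (siteCluster zdStarGraph (spinSites 1 ω ∩ halfPlane 0) ![k, 0]).Infinite := by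
  set φ := starShiftIso (Pi.single 0 s) with hφ
  have hcfg : (configShift (S := ℤˣ) (Pi.single 0 s) ω : SpinConfig (Site 2)) = configRelabel φ.toEquiv ω := rfl
  have hO : spinSites 1 (configShift (S := ℤˣ) (Pi.single 0 s) ω) ∩ halfPlane 0 = φ '' (spinSites 1 ω ∩ halfPlane 0) := by
    rw [hcfg, spinSites_configRelabel, image_starShiftIso_inter_halfPlane]; rfl
  have key : ∀ y : Site 2, siteCluster zdStarGraph (φ '' (spinSites 1 ω ∩ halfPlane 0)) (φ y) =
      φ '' siteCluster zdStarGraph (spinSites 1 ω ∩ halfPlane 0) y := fun y => by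
    have h := siteCluster_relabel φ (spinSites 1 ω ∩ halfPlane 0) y
    rwa [SiteConfig.relabel_apply] at h
  have hpt : ∀ k : ℤ, φ (![k - s, 0] : Site 2) = ![k, 0] := fun k => by
    rw [hφ, starShiftIso_apply]; ext i; fin_cases i <;> simp
  rw [hO]
  constructor
  · rintro ⟨k, hjk, hinf⟩
    refine ⟨k - s, by omega, ?_⟩
    rw [← hpt k, key] at hinf
    exact Set.Infinite.of_image _ hinf
  · rintro ⟨k, hjk, hinf⟩
    refine ⟨k + s, by omega, ?_⟩
    have := hpt (k + s)
    rw [show k + s - s = k by ring] at this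
    rw [← this, key]
    exact hinf.image φ.injective.injOn

/-- **Comparison for the horizontally shifted layer** (the event fed into the touching criterion):
for `s = ±1` and `μ̂ = μ ∘ θ_{s e₁}⁻¹`, the `μ ⊗ μ̂`-probability of "`a(ω) ≤ a(ω̂)`", i.e. of
`{∃ j, ω ∉ R_{j+1} ∧ ω̂ ∈ R_j}`, is at least `(1 - (1+δ₀)⁻¹)/2 = δ₀/(2(1+δ₀))`, `δ₀ = e^{-8|β|}/2`,
provided the last axis site exists almost surely. [cite: GeorgiiHiguchi2000, Lemma 5.4 (proof, p. 14)] -/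
theorem le_measure_axisReach_shift (hμ : μ ∈ isingGibbsMeasures 2 β 0)
    (hexists : ∀ᵐ ω ∂μ, ∃ j : ℤ, ω ∈ {ω : SpinConfig (Site 2) | ∃ k : ℤ, j ≤ k ∧
        (siteCluster zdStarGraph (spinSites 1 ω ∩ halfPlane 0) ![k, 0]).Infinite} \
      {ω | ∃ k : ℤ, j + 1 ≤ k ∧ (siteCluster zdStarGraph (spinSites 1 ω ∩ halfPlane 0) ![k, 0]).Infinite})
    (s : ℤˣ) :
    (1 - (1 + ENNReal.ofReal (Real.exp (-(8 * |β|)) / 2))⁻¹) / 2 ≤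
      (μ.prod (μ.map (configShift (Pi.single 0 (s : ℤ)))))
        {p : SpinConfig (Site 2) × SpinConfig (Site 2) | ∃ j : ℤ,
          (¬ ∃ k : ℤ, j + 1 ≤ k ∧ (siteCluster zdStarGraph (spinSites 1 p.1 ∩ halfPlane 0) ![k, 0]).Infinite) ∧
          (∃ k : ℤ, j ≤ k ∧ (siteCluster zdStarGraph (spinSites 1 p.2 ∩ halfPlane 0) ![k, 0]).Infinite)} := by
  have hμG : IsGibbsMeasure (isingSpecification (zdGraph 2) β 0) μ := hμ
  haveI := hμG.isProbabilityMeasure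
  set R : ℤ → Set (SpinConfig (Site 2)) := fun j =>
    {ω : SpinConfig (Site 2) | ∃ k : ℤ, j ≤ k ∧ (siteCluster zdStarGraph (spinSites 1 ω ∩ halfPlane 0) ![k, 0]).Infinite} with hR
  set T : SpinConfig (Site 2) → SpinConfig (Site 2) := ⇑(configShift (S := ℤˣ) (Pi.single (0 : Fin 2) (s : ℤ))) with hT
  have hTm : Measurable T := (configShift (S := ℤˣ) (Pi.single (0 : Fin 2) (s : ℤ))).measurable
  set A := {p : SpinConfig (Site 2) × SpinConfig (Site 2) | ∃ j : ℤ, p.1 ∉ R (j + 1) ∧ p.2 ∈ R j} with hA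
  have hAm : MeasurableSet A := by
    have : A = ⋃ j : ℤ, (R (j + 1))ᶜ ×ˢ R j := by ext p; simp [hA, Set.mem_prod]
    rw [this]
    exact MeasurableSet.iUnion fun j => (measurableSet_axisReach (j + 1)).compl.prod (measurableSet_axisReach j)
  -- push the shift onto the event
  have hprod : μ.prod (μ.map T) = (μ.prod μ).map (Prod.map id T) := by
    rw [← Measure.map_prod_map μ μ measurable_id hTm, Measure.map_id]
  have hpre : (Prod.map id T) ⁻¹' A = {p : SpinConfig (Site 2) × SpinConfig (Site 2) | ∃ j : ℤ,
      p.1 ∉ R (j + 1) ∧ p.2 ∈ R (j - s)} := by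
    ext p
    simp only [hA, Set.mem_preimage, Prod.map_fst, Prod.map_snd, id_eq, Set.mem_setOf_eq]
    constructor
    · rintro ⟨j, h1, h2⟩
      exact ⟨j, h1, (axisReach_configShift_iff (s : ℤ) j p.2).1 h2⟩
    · rintro ⟨j, h1, h2⟩
      exact ⟨j, h1, (axisReach_configShift_iff (s : ℤ) j p.2).2 h2⟩
  change _ ≤ (μ.prod (μ.map T)) A
  rw [hprod, Measure.map_apply (measurable_id.prodMap hTm) hAm, hpre]
  have hanti : ∀ {j j' : ℤ} {ω}, j ≤ j' → ω ∈ R j' → ω ∈ R j := fun hjj' h => axisReach_anti hjj' h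
  rcases Int.units_eq_one_or s with hs | hs
  · -- `s = 1`: the event contains `{a(ω) ≤ a(ω')}`, of probability `≥ 1/2`
    rw [hs, Units.val_one]
    have hhalf := half_le_measure_axisReach_ge hμ hexists
    have hinv_le : (1 + ENNReal.ofReal (Real.exp (-(8 * |β|)) / 2))⁻¹ ≤ 1 := ENNReal.inv_le_one.2 le_self_add
    have hsub : {p : SpinConfig (Site 2) × SpinConfig (Site 2) | ∃ j : ℤ, p.1 ∉ R (j + 1) ∧ p.2 ∈ R j} ⊆
        {p : SpinConfig (Site 2) × SpinConfig (Site 2) | ∃ j : ℤ, p.1 ∉ R (j + 1) ∧ p.2 ∈ R (j - 1)} := by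
      rintro p ⟨j, h1, h2⟩; exact ⟨j, h1, hanti (by omega) h2⟩
    calc (1 - (1 + ENNReal.ofReal (Real.exp (-(8 * |β|)) / 2))⁻¹) / 2 ≤ 1 / 2 :=
          ENNReal.div_le_div_right tsub_le_self 2
      _ ≤ _ := hhalf
      _ ≤ _ := measure_mono hsub
  · -- `s = -1`: the event is `{a(ω) < a(ω')}`
    rw [hs, Units.val_neg, Units.val_one]
    have hgt := le_measure_axisReach_gt hμ hexists
    have hsub : {p : SpinConfig (Site 2) × SpinConfig (Site 2) | ∃ j : ℤ, p.1 ∉ R j ∧ p.2 ∈ R j} ⊆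
        {p : SpinConfig (Site 2) × SpinConfig (Site 2) | ∃ j : ℤ, p.1 ∉ R (j + 1) ∧ p.2 ∈ R (j - -1)} := by
      rintro p ⟨j, h1, h2⟩
      refine ⟨j - 1, ?_, ?_⟩
      · rw [show j - 1 + 1 = j by ring]; exact h1
      · rw [show j - 1 - (-1 : ℤ) = j by ring]; exact h2
    exact hgt.trans (measure_mono hsub)

end Shift

end Literature.Probability.LatticeModels
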